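import Literature.NumberTheory.Sieve.AsymptoticSieveForPrimesRough
import Literature.NumberTheory.Sieve.FriedlanderIwaniecPrimesHyp27Unconditional
import Literature.NumberTheory.Sieve.FriedlanderIwaniecPrimesMainTermProofs
import HarnessLib

/-!
# Friedlander–Iwaniec, *The polynomial `X² + Y⁴` captures its primes*: parity.S17 from the asymptotic sieve with `(B*)`, Lemma 3.1 and Proposition 4.1

Family `parity`, statement parity.S17 (`Literature.NumberTheory.Sieve.friedlanderIwaniecSum_isEquivalent`,
FI Theorem 1; qualitative clause `Literature.NumberTheory.Sieve.setOf_prime_sq_add_pow_four_infinite`).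
Sources: J. Friedlander, H. Iwaniec, *The polynomial `X² + Y⁴` captures its primes*, Ann. of Math.
(2) 148 (1998), 945–1040 [FriedlanderIwaniecAnnals1998] (= arXiv:math/9811185), §2 (2.1)–(2.17)
and Proposition 2.1, §4 (4.7)–(4.8); J. Friedlander, H. Iwaniec, *Asymptotic sieve for primes*,
ibid. 1041–1065 [FriedlanderIwaniecASP1998], §1 (R), (B1), (B3), (1.16) and §10 (10.1)–(10.2),
(B*), Theorem 3.

## What this file does (the sequel announced in `AsymptoticSieveForPrimesRough`)

The tree derives parity.S17 from three named facts of [FriedlanderIwaniecAnnals1998]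
(`friedlanderIwaniecSum_isEquivalent_of_printedInputs`, `FriedlanderIwaniecPrimesHyp27Unconditional`):
Proposition 2.1 AS PRINTED for ALL sequences (`FriedlanderIwaniec1998_prop21` = ASP Theorems 2–3
combined), Proposition 3.5 (itself reduced to Lemma 3.1, `FriedlanderIwaniec1998_prop35_of_lemma31`)
and Proposition 4.1 — Proposition 2.1 being applied only to the squarefree-supported sequence
`a'_n = μ²(n) a_n` (`fiSieveSeqSq`, `FriedlanderIwaniecPrimesSquarefreeProofs`). For a sequence
supported on squarefree integers, the hypotheses (2.1)–(2.15) of Proposition 2.1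
(`SieveSequence.FI1998SieveHypotheses`) contain those of ASP Theorem 1 with (B) replaced by (B*)
(`SieveSequence.FIAsymptoticSieveHypothesesRough` of `AsymptoticSieveForPrimesRough`: the core clauses
(1.4), (1.6), (1.8), (1.9), (1.16), (R1), (R) and (B*) with (10.2)), whose conclusion is the named
fact `fi_asymptotic_sieve_primes_rough_loglog` — ASP Theorem 1 (PROVED in the tree,
`fi_asymptotic_sieve_primes_loglog_holds`) with the single modification of ASP §10. This file proves
that containment and re-routes the assembly of parity.S17 through it:

* `SieveSequence.fiBilinearRough_inner_eq`, `SieveSequence.fiBilinearRough_le_fiBilinearPi`: on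
  squarefree support the two printings of the restricted bilinear form agree up to the sign `μ(m)`:
  `∑_{(n,Π)=1} γ(n,C) μ(mn) a_{mn} = μ(m) ∑_{(n,mΠ)=1} μ(n) γ(n,C) a_{mn}` (if `a_{mn} ≠ 0` then `mn`
  is squarefree, so `(m,n) = 1` and `μ(mn) = μ(m)μ(n)`), whence `B*_rough ≤ B_Π` ((B*) of
  [FriedlanderIwaniecASP1998] versus (2.11) of [FriedlanderIwaniecAnnals1998]);
* `SieveSequence.FI1998SieveHypotheses.toRough`: (2.1)–(2.15) and (1.16) imply
  `FIAsymptoticSieveHypothesesRough` with the same `D, δ, Δ, P` ((R) at level `D` with saving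
  `(log x)^{-2^{22}}` is weaker than (2.9) at level `DL²` with saving `L⁻² = (log x)^{-2^{25}}` over
  the larger set of cubefree moduli; (1.8) is (2.4)–(2.5));
* `prop21_squarefree_of_rough_loglog`: hence `fi_asymptotic_sieve_primes_rough_loglog` gives the
  conclusion (2.16) of Proposition 2.1 (regime `δ = (log x)^α`, `Δ = x^θ`, `0 < θ < 1/3`, error
  `O(log log x / log x)`) for every squarefree-supported sequence satisfying (2.1)–(2.15);
* the assemblies `FriedlanderIwaniec1998_primeSum_asymp_of_rough_inputs`
  (`rough_loglog → _prop35 → _prop41 → (4.7)`), `friedlanderIwaniecSum_isEquivalent_of_rough_inputs`,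
  `setOf_prime_sq_add_pow_four_infinite_of_rough_inputs`, and the same with Proposition 3.5 replaced
  by Lemma 3.1 (`…_of_rough_lemma31_inputs`).

After this file the trust base of parity.S17 in the tree is: ASP Theorem 1 with (B*) (§10 of
[FriedlanderIwaniecASP1998] on top of the proved Theorem 1), FI Lemma 3.1 (harmonic analysis, §3)
and FI Proposition 4.1 (§§4–26).

## References

* J. Friedlander, H. Iwaniec, *The polynomial `X² + Y⁴` captures its primes*, Ann. of Math. (2)
  148 (1998), 945–1040, §2 Proposition 2.1, §4 (4.7)–(4.8). [cite: FriedlanderIwaniecAnnals1998, Proposition 2.1]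
* J. Friedlander, H. Iwaniec, *Asymptotic sieve for primes*, Ann. of Math. (2) 148 (1998),
  1041–1065, §10 (10.1)–(10.2), (B*), Theorem 3. [cite: FriedlanderIwaniecASP1998, §10 Theorem 3]

## Mathlib / tree search

Tree (reused, nothing redefined): `SieveSequence.fiBilinearRough`, `FIAsymptoticSieveHypothesesCore`,
`FIAsymptoticSieveHypothesesRough`, `fi_asymptotic_sieve_primes_rough_loglog`
(`AsymptoticSieveForPrimesRough`); `SieveSequence.fiBilinearPi`, `FI1998SieveHypotheses`,
`IsCubefree.of_squarefree` (`FriedlanderIwaniecPrimes`); `fiSieveSeqSq`, `sieveHypotheses_sq`,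
`levelSq_and_countSq`, `fiSqProd_sub_fiSqConst_le`, `hasDensityConstant_fiSieveSeqSq_of_densityConstant`
(`FriedlanderIwaniecPrimesSquarefree{,Proofs}`); `FriedlanderIwaniec1998_hyp27_holds`
(`…Hyp27Unconditional`); `FriedlanderIwaniec1998_prop35_of_lemma31` (`…MainTermProofs`).
Mathlib: `Nat.squarefree_mul_iff`, `ArithmeticFunction.isMultiplicative_moebius`,
`ArithmeticFunction.abs_moebius_le_one`. `lean search 'fiBilinearRough_le|toRough|of_rough_inputs'`:
no declaration before this file.
-/

noncomputable section

open Filter Asymptotics Finset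
open scoped ArithmeticFunction.Moebius ArithmeticFunction.sigma

namespace Literature.NumberTheory.Sieve

namespace SieveSequence

/-! ### The two printings of the restricted bilinear form on squarefree support -/

/-- On squarefree support, the inner sum of (B*) of [FriedlanderIwaniecASP1998] at `m` is `μ(m)`
times the inner sum of (2.11) of [FriedlanderIwaniecAnnals1998]:
`∑_{N<n≤2N, mn≤x, (n,Π)=1} γ(n,C) μ(mn) a_{mn} = μ(m) ∑_{N<n≤2N, mn≤x, (n,mΠ)=1} μ(n) γ(n,C) a_{mn}`
(a term with `a_{mn} ≠ 0` has `mn` squarefree, hence `(m, n) = 1` and `μ(mn) = μ(m) μ(n)`).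
[cite: FriedlanderIwaniecASP1998, §10 (10.1) and (B*)] -/
theorem fiBilinearRough_inner_eq {A : SieveSequence} (hA : ∀ n : ℕ, ¬Squarefree n → A.a n = 0)
    (x N C P : ℝ) (m : ℕ) :
    ∑ n ∈ (Ioc ⌊N⌋₊ ⌊2 * N⌋₊).filter
        (fun n : ℕ => ((m * n : ℕ) : ℝ) ≤ x ∧ ∀ p ∈ n.primeFactors, P ≤ (p : ℝ)),
      (fiGamma C n : ℝ) * (μ (m * n) : ℝ) * A.a (m * n) =
    (μ m : ℝ) * ∑ n ∈ (Ioc ⌊N⌋₊ ⌊2 * N⌋₊).filter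
        (fun n : ℕ => ((m * n : ℕ) : ℝ) ≤ x ∧ n.Coprime m ∧ ∀ p ∈ n.primeFactors, P ≤ (p : ℝ)),
      (μ n : ℝ) * (fiGamma C n : ℝ) * A.a (m * n) := by
  rw [Finset.mul_sum, Finset.sum_filter, Finset.sum_filter]
  refine Finset.sum_congr rfl fun n _ => ?_
  by_cases ha : A.a (m * n) = 0
  · simp [ha]
  · have hsq : Squarefree (m * n) := by
      by_contra h
      exact ha (hA _ h)
    obtain ⟨hcop, -, -⟩ := Nat.squarefree_mul_iff.mp hsq
    have hμ : (μ (m * n) : ℝ) = (μ m : ℝ) * (μ n : ℝ) := by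
      rw [ArithmeticFunction.isMultiplicative_moebius.map_mul_of_coprime hcop]
      push_cast
      ring
    by_cases hc : ((m * n : ℕ) : ℝ) ≤ x ∧ ∀ p ∈ n.primeFactors, P ≤ (p : ℝ)
    · rw [if_pos hc, if_pos ⟨hc.1, hcop.symm, hc.2⟩, hμ]
      ring
    · rw [if_neg hc, if_neg (fun h => hc ⟨h.1, h.2.2⟩)]

/-- **`B* ≤ B_Π` on squarefree support**: for a sequence vanishing off the squarefree integers
((1.16) of [FriedlanderIwaniecASP1998]), the bilinear form of (B*) (`fiBilinearRough`:
`γ(n,C) μ(mn) a_{mn}` over `(n, Π) = 1`) is at most the bilinear form (2.11) of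
[FriedlanderIwaniecAnnals1998] (`fiBilinearPi`: `μ(n) γ(n,C) a_{mn}` over `(n, mΠ) = 1`); in fact the
`m`-th terms are equal for squarefree `m` and the former vanishes otherwise.
[cite: FriedlanderIwaniecASP1998, §10 (B*)] -/
theorem fiBilinearRough_le_fiBilinearPi {A : SieveSequence}
    (hA : ∀ n : ℕ, ¬Squarefree n → A.a n = 0) (x N C P : ℝ) :
    A.fiBilinearRough x N C P ≤ A.fiBilinearPi x N C P := by
  rw [fiBilinearRough, fiBilinearPi]
  refine Finset.sum_le_sum fun m _ => ?_
  rw [fiBilinearRough_inner_eq hA x N C P m, abs_mul]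
  have hμ : |(μ m : ℝ)| ≤ 1 := by exact_mod_cast ArithmeticFunction.abs_moebius_le_one
  calc |(μ m : ℝ)| * |∑ n ∈ (Ioc ⌊N⌋₊ ⌊2 * N⌋₊).filter
          (fun n : ℕ => ((m * n : ℕ) : ℝ) ≤ x ∧ n.Coprime m ∧ ∀ p ∈ n.primeFactors, P ≤ (p : ℝ)),
          (μ n : ℝ) * (fiGamma C n : ℝ) * A.a (m * n)|
      ≤ 1 * |∑ n ∈ (Ioc ⌊N⌋₊ ⌊2 * N⌋₊).filter
          (fun n : ℕ => ((m * n : ℕ) : ℝ) ≤ x ∧ n.Coprime m ∧ ∀ p ∈ n.primeFactors, P ≤ (p : ℝ)),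
          (μ n : ℝ) * (fiGamma C n : ℝ) * A.a (m * n)| :=
        mul_le_mul_of_nonneg_right hμ (abs_nonneg _)
    _ = _ := one_mul _

/-! ### (2.1)–(2.15) with (1.16) imply the hypotheses of ASP Theorem 1 with (B*) -/

/-- **The hypotheses of FI's Proposition 2.1 for a squarefree-supported sequence imply those of
ASP Theorem 1 with (B*)** (same `D, δ, Δ, P`): the core clauses `size_eq`, (1.4) = (2.1),
(1.6) = (2.8), (1.8) ⇐ (2.4)–(2.5), (1.9) = (2.7), (1.16) (assumed), (R1) ⇐ (2.10), and
(R) `∑_{d ≤ D, d squarefree} |r_d(t)| ≤ A(x)(log x)^{-2^{22}}` ⇐ (2.9)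
`∑_{d ≤ DL², d cubefree} |r_d(t)| ≤ A(x) L⁻²`, `L = (log x)^{2^{24}}` (fewer moduli, weaker saving,
for `log x ≥ 1`); the parameter clause `δ, Δ, P ≥ 2`, (10.2) = (2.15); and (B*) ⇐ (2.11) by
`fiBilinearRough_le_fiBilinearPi`.
[cite: FriedlanderIwaniecASP1998, §10 (B*) with §1 (R); FriedlanderIwaniecAnnals1998 (2.1)-(2.15)] -/
theorem FI1998SieveHypotheses.toRough {A : SieveSequence} {D δ Δ P : ℝ → ℝ}
    (h : A.FI1998SieveHypotheses D δ Δ P) (hA : ∀ n : ℕ, ¬Squarefree n → A.a n = 0) :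
    A.FIAsymptoticSieveHypothesesRough D δ Δ P := by
  obtain ⟨hsize, h21, -, h24, h2526, h27, h28, hpar, h29, h211⟩ := h
  refine ⟨⟨hsize, h21, h28, ?_, h27, hA, hpar.mono fun x hx => ⟨hx.1, hx.2.1⟩, ?_⟩, ?_, ?_⟩
  · -- (1.8) from (2.4) and (2.5)
    obtain ⟨K, hK⟩ := h2526
    exact ⟨K, fun p hp => ⟨(h24 p hp).1.trans (h24 p hp).2.1, (h24 p hp).2.2, (hK p hp).1⟩⟩
  · -- (R) from (2.9)
    filter_upwards [h29, hpar, eventually_ge_atTop (Real.exp 1)] with x hx hparx hxe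
    intro t ht
    have hx0 : 0 < x := (Real.exp_pos 1).trans_le hxe
    have hlog : 1 ≤ Real.log x := by rwa [Real.le_log_iff_exp_le hx0]
    have hlog0 : 0 < Real.log x := one_pos.trans_le hlog
    have hD0 : 0 ≤ D x := ((Real.rpow_nonneg hx0.le _).trans_lt hparx.1).le
    have hL1 : 1 ≤ Real.log x ^ (2 ^ 24 : ℕ) := one_le_pow₀ hlog
    have hsub : (Icc 1 ⌊D x⌋₊).filter Squarefree ⊆
        (Icc 1 ⌊D x * (Real.log x ^ (2 ^ 24 : ℕ)) ^ 2⌋₊).filter IsCubefree := by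
      intro d hd
      rw [Finset.mem_filter] at hd ⊢
      refine ⟨?_, IsCubefree.of_squarefree hd.2⟩
      rw [Finset.mem_Icc] at hd ⊢
      refine ⟨hd.1.1, hd.1.2.trans (Nat.floor_mono ?_)⟩
      calc D x = D x * 1 := (mul_one _).symm
        _ ≤ D x * (Real.log x ^ (2 ^ 24 : ℕ)) ^ 2 :=
            mul_le_mul_of_nonneg_left (one_le_pow₀ hL1) hD0
    have hA0 : 0 ≤ A.size x := by rw [hsize]; exact A.congrSum_nonneg 1 x
    calc ∑ d ∈ (Icc 1 ⌊D x⌋₊).filter Squarefree, |A.remainder d t|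
        ≤ ∑ d ∈ (Icc 1 ⌊D x * (Real.log x ^ (2 ^ 24 : ℕ)) ^ 2⌋₊).filter IsCubefree,
            |A.remainder d t| :=
          Finset.sum_le_sum_of_subset_of_nonneg hsub fun _ _ _ => abs_nonneg _
      _ ≤ A.size x / (Real.log x ^ (2 ^ 24 : ℕ)) ^ 2 := hx t ht
      _ ≤ A.size x / Real.log x ^ fiLogSaving := by
          refine div_le_div_of_nonneg_left hA0 (pow_pos hlog0 _) ?_
          rw [fiLogSaving, ← pow_mul]
          exact pow_le_pow_right₀ hlog (by norm_num)
  · exact hpar.mono fun x hx =>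
      ⟨hx.2.2.1, hx.2.2.1.trans hx.2.2.2.1, hx.2.2.2.2.1, hx.2.2.2.2.2⟩
  · filter_upwards [h211] with x hx
    intro N hN1 hN2 C hC1 hC2
    exact (fiBilinearRough_le_fiBilinearPi hA x N C (P x)).trans (hx C hC1 hC2 N hN1 hN2)

end SieveSequence

/-! ### Proposition 2.1 for squarefree-supported sequences from ASP Theorem 1 with (B*) -/

/-- **FI Proposition 2.1 on squarefree support from `fi_asymptotic_sieve_primes_rough_loglog`.**
If ASP Theorem 1 holds with (B) replaced by (B*) (the named fact of `AsymptoticSieveForPrimesRough`,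
[FriedlanderIwaniecASP1998] §10), then every sequence supported on squarefree integers and
satisfying (2.1)–(2.15) of [FriedlanderIwaniecAnnals1998] with `δ = (log x)^α`, `Δ = x^θ`
(`α > 0`, `0 < θ < 1/3`) and `H = ∏_p (1 - g(p))(1 - 1/p)⁻¹` satisfies (2.16):
`∑_{p ≤ x} a_p log p = H A(x)(1 + O(log log x / log x))` — i.e. the conclusion of
`FriedlanderIwaniec1998_prop21` in the only case the proof of Theorem 1 uses.
[cite: FriedlanderIwaniecAnnals1998, Proposition 2.1 (2.16); FriedlanderIwaniecASP1998 §10 Theorem 3] -/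
theorem prop21_squarefree_of_rough_loglog (h : fi_asymptotic_sieve_primes_rough_loglog)
    (A : SieveSequence) (D P : ℝ → ℝ) (α θ H : ℝ) (hα : 0 < α) (hθ : 0 < θ) (hθ3 : θ < 1 / 3)
    (hA : ∀ n : ℕ, ¬Squarefree n → A.a n = 0)
    (hhyp : A.FI1998SieveHypotheses D (fun x => Real.log x ^ α) (fun x => x ^ θ) P)
    (hH : A.HasDensityConstant H) :
    (fun x : ℝ => (∑ p ∈ Nat.primesLE ⌊x⌋₊, A.a p * Real.log p) - H * A.size x) =O[atTop]
      fun x : ℝ => H * A.size x * (Real.log (Real.log x) / Real.log x) :=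
  h A D P α θ H hα hθ hθ3 (hhyp.toRough hA) hH

/-! ### (4.7) and parity.S17 from ASP-with-(B*), Proposition 3.5 / Lemma 3.1 and Proposition 4.1 -/

namespace FriedlanderIwaniecPrimesSquarefree

open FriedlanderIwaniecPrimes

/-- `a'_n = μ²(n) a_n` vanishes off the squarefree integers ((1.16) of [FriedlanderIwaniecASP1998]
for `fiSieveSeqSq`). [folklore] -/
theorem fiSieveSeqSq_a_eq_zero {n : ℕ} (hn : ¬Squarefree n) : fiSieveSeqSq.a n = 0 := by
  rw [fiSieveSeqSq_a, if_neg hn]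

/-- **(4.7) with (4.8) for `a_n` from ASP Theorem 1 with (B*) applied to `a'`.** As
`primeSum_asymp_of_sq_inputs`, with the printed Proposition 2.1 (`FriedlanderIwaniec1998_prop21`,
all sequences) replaced by `fi_asymptotic_sieve_primes_rough_loglog` through
`prop21_squarefree_of_rough_loglog`: the hypotheses (2.1)–(2.15) of `a'` (`sieveHypotheses_sq`, from
Propositions 3.5, 4.1 and (2.7)) give `S(x) = H' A'(x)(1 + O(log log x / log x))`,
`H' = (4/π)/P_∞`, and `A'(x) = P_∞ A(x)(1 + O(x^{-1/500} + 1/x))` gives (4.7).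
[cite: FriedlanderIwaniecAnnals1998, §4, (4.7)-(4.8)] -/
theorem primeSum_asymp_of_rough_inputs (hR : fi_asymptotic_sieve_primes_rough_loglog)
    (h35 : FriedlanderIwaniec1998_prop35) (h41 : FriedlanderIwaniec1998_prop41)
    (h27 : FriedlanderIwaniec1998_hyp27) : FriedlanderIwaniec1998_primeSum_asymp := by
  obtain ⟨B, hB, hhyp⟩ := sieveHypotheses_sq h35 h41 h27
  set H' : ℝ := 4 / Real.pi / fiSqConst with hH'
  have hP := fiSqConst_pos
  have hH'0 : 0 < H' := by rw [hH']; positivity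
  have hHP : H' * fiSqConst = 4 / Real.pi := by rw [hH']; field_simp
  have h := prop21_squarefree_of_rough_loglog hR fiSieveSeqSq (fun x => x ^ (17 / 25 : ℝ)) fiP B
    fiEps H' hB (by norm_num [fiEps]) (by norm_num [fiEps]) (fun n hn => fiSieveSeqSq_a_eq_zero hn)
    hhyp (hasDensityConstant_fiSieveSeqSq_of_densityConstant
      FriedlanderIwaniec1998_densityConstant_holds)
  simp only [fiSieveSeqSq_primeSum] at h
  change (fun x => fiPrimeSum x - H' * fiCountSq x) =O[atTop]
    (fun x => H' * fiCountSq x * (Real.log (Real.log x) / Real.log x)) at h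
  -- Step 1: `H' A'(x) ≤ (1/P_∞) (4/π) A(x)`
  have h1 : (fun x => fiPrimeSum x - H' * fiCountSq x) =O[atTop]
      (fun x => 4 / Real.pi * fiCount x * (Real.log (Real.log x) / Real.log x)) := by
    refine h.trans (Asymptotics.IsBigO.of_bound (1 / fiSqConst) (Filter.Eventually.of_forall fun x => ?_))
    have hA' := fiCountSq_le_fiCount x
    have hA'0 := fiCountSq_nonneg x
    have hA0 := fiCount_nonneg x
    rw [Real.norm_eq_abs, Real.norm_eq_abs, abs_mul (H' * fiCountSq x), abs_mul (4 / Real.pi * fiCount x),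
      abs_of_nonneg (mul_nonneg hH'0.le hA'0), abs_of_nonneg (mul_nonneg (by positivity) hA0)]
    calc H' * fiCountSq x * |Real.log (Real.log x) / Real.log x|
        ≤ H' * fiCount x * |Real.log (Real.log x) / Real.log x| := by gcongr
      _ = 1 / fiSqConst * (4 / Real.pi * fiCount x * |Real.log (Real.log x) / Real.log x|) := by
          rw [hH']; field_simp
  -- Step 2: `H' A'(x) - (4/π) A(x) = H' (A'(x) - P_∞ A(x))` is `O(A(x) (x^{-1/500} + 1/x))`
  have h2 : (fun x => H' * fiCountSq x - 4 / Real.pi * fiCount x) =O[atTop]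
      (fun x => 4 / Real.pi * fiCount x * (Real.log (Real.log x) / Real.log x)) := by
    have hll : Tendsto (fun x : ℝ => Real.log (Real.log x)) atTop atTop :=
      Real.tendsto_log_atTop.comp Real.tendsto_log_atTop
    have hl1 : ∀ᶠ x : ℝ in atTop, ‖Real.log x‖ ≤ 1 * ‖x ^ (1 / 500 : ℝ)‖ :=
      (isLittleO_log_rpow_atTop (by norm_num : (0 : ℝ) < 1 / 500)).def one_pos
    have hl2 : ∀ᶠ x : ℝ in atTop, ‖Real.log x‖ ≤ 1 / 6 * ‖x ^ (1 : ℝ)‖ :=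
      (isLittleO_log_rpow_atTop (by norm_num : (0 : ℝ) < 1)).def (by norm_num)
    refine Asymptotics.IsBigO.of_bound (2 / fiSqConst) ?_
    filter_upwards [levelSq_and_countSq h35, hl1, hl2, hll.eventually_ge_atTop 1,
      eventually_ge_atTop (2 : ℝ)] with x hlev hl1 hl2 hll1 hx2
    have hx0 : 0 < x := by linarith
    have hx1 : 1 < x := by linarith
    have hlog0 : 0 < Real.log x := Real.log_pos hx1
    rw [Real.rpow_one] at hl2
    rw [Real.norm_eq_abs, Real.norm_eq_abs, abs_of_pos hlog0] at hl1 hl2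
    rw [abs_of_nonneg (by positivity)] at hl1
    rw [abs_of_nonneg hx0.le] at hl2
    obtain ⟨hX1, hXle, hXge⟩ := floor_facts hx2
    have hA := fiCount_nonneg x
    -- `|A'(x) - P_∞ A(x)| ≤ A(x) (x^{-1/500} + 3/⌊x⌋)`
    have hd : |fiCountSq x - fiSqConst * fiCount x| ≤
        fiCount x * (x ^ (-(1 / 500 : ℝ)) + 3 / ⌊x⌋₊) := by
      have e : fiCountSq x - fiSqConst * fiCount x =
          (fiCountSq x - fiSqProd ⌊x⌋₊ * fiCount x) + (fiSqProd ⌊x⌋₊ - fiSqConst) * fiCount x := by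
        ring
      rw [e, mul_add]
      refine (abs_add_le _ _).trans (add_le_add (hlev.2 x le_rfl) ?_)
      rw [abs_mul, abs_of_nonneg hA, abs_of_nonneg (fiSqProd_sub_fiSqConst_le hX1).1, mul_comm]
      exact mul_le_mul_of_nonneg_left (fiSqProd_sub_fiSqConst_le hX1).2 hA
    -- `x^{-1/500} + 3/⌊x⌋ ≤ 2 / log x ≤ 2 log log x / log x`
    have hsmall : x ^ (-(1 / 500 : ℝ)) + 3 / ⌊x⌋₊ ≤ 2 * (Real.log (Real.log x) / Real.log x) := by
      have e1 : x ^ (-(1 / 500 : ℝ)) ≤ 1 / Real.log x := by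
        rw [Real.rpow_neg hx0.le, ← one_div, div_le_div_iff₀ (by positivity) hlog0]; linarith
      have e2 : 3 / (⌊x⌋₊ : ℝ) ≤ 1 / Real.log x := by
        rw [div_le_div_iff₀ (by exact_mod_cast hX1) hlog0]; linarith
      have e3 : 1 / Real.log x ≤ Real.log (Real.log x) / Real.log x :=
        div_le_div_of_nonneg_right hll1 hlog0.le
      linarith
    have hr0 : 0 ≤ Real.log (Real.log x) / Real.log x := div_nonneg (by linarith) hlog0.le
    rw [Real.norm_eq_abs, Real.norm_eq_abs,
      abs_of_nonneg (mul_nonneg (mul_nonneg (by positivity) hA) hr0)]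
    have e : H' * fiCountSq x - 4 / Real.pi * fiCount x = H' * (fiCountSq x - fiSqConst * fiCount x) := by
      rw [← hHP]; ring
    rw [e, abs_mul, abs_of_pos hH'0]
    calc H' * |fiCountSq x - fiSqConst * fiCount x|
        ≤ H' * (fiCount x * (x ^ (-(1 / 500 : ℝ)) + 3 / ⌊x⌋₊)) :=
          mul_le_mul_of_nonneg_left hd hH'0.le
      _ ≤ H' * (fiCount x * (2 * (Real.log (Real.log x) / Real.log x))) := by gcongr
      _ = 2 / fiSqConst * (4 / Real.pi * fiCount x * (Real.log (Real.log x) / Real.log x)) := by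
          rw [hH']; field_simp
  -- Step 3: add
  refine (h1.add h2).congr_left fun x => ?_
  ring

end FriedlanderIwaniecPrimesSquarefree

open FriedlanderIwaniecPrimesSquarefree

/-- **FI (4.7)–(4.8) from ASP Theorem 1 with (B*), Proposition 3.5 and Proposition 4.1.** The named
fact `FriedlanderIwaniec1998_primeSum_asymp` (`S(x) = (4/π) A(x)(1 + O(log log x/log x))`) follows
from `fi_asymptotic_sieve_primes_rough_loglog` ([FriedlanderIwaniecASP1998] Theorem 1 with (B*), the
case of FI Proposition 2.1 that is used), FI Proposition 3.5 and FI Proposition 4.1; (2.7) is the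
tree's `FriedlanderIwaniec1998_hyp27_holds`, and (2.2), (4.2), (4.8), the squarefree reduction are
theorems of the tree. [cite: FriedlanderIwaniecAnnals1998, §4, (4.7)-(4.8) from Propositions 2.1, 3.5, 4.1] -/
theorem FriedlanderIwaniec1998_primeSum_asymp_of_rough_inputs
    (hR : fi_asymptotic_sieve_primes_rough_loglog) (h35 : FriedlanderIwaniec1998_prop35)
    (h41 : FriedlanderIwaniec1998_prop41) : FriedlanderIwaniec1998_primeSum_asymp :=
  primeSum_asymp_of_rough_inputs hR h35 h41 FriedlanderIwaniec1998_hyp27_holds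

/-- **Friedlander–Iwaniec Theorem 1 (parity.S17, `∑∑_{a²+b⁴≤x} Λ(a²+b⁴) ∼ 4π⁻¹κ x^{3/4}`) from
ASP Theorem 1 with (B*), FI Proposition 3.5 and FI Proposition 4.1** (named facts), everything else
in FI's deduction being proved in the tree.
[cite: FriedlanderIwaniecAnnals1998, Theorem 1 via Propositions 2.1, 3.5, 4.1] -/
theorem friedlanderIwaniecSum_isEquivalent_of_rough_inputs
    (hR : fi_asymptotic_sieve_primes_rough_loglog) (h35 : FriedlanderIwaniec1998_prop35)
    (h41 : FriedlanderIwaniec1998_prop41) : friedlanderIwaniecSum_isEquivalent :=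
  friedlanderIwaniecSum_isEquivalent_of_primeSum
    (FriedlanderIwaniec1998_primeSum_asymp_of_rough_inputs hR h35 h41)

/-- **parity.S17, qualitative clause** (infinitely many primes `p = a² + b⁴`) from ASP Theorem 1
with (B*), FI Proposition 3.5 and FI Proposition 4.1. [cite: FriedlanderIwaniecAnnals1998, Theorem 1] -/
theorem setOf_prime_sq_add_pow_four_infinite_of_rough_inputs
    (hR : fi_asymptotic_sieve_primes_rough_loglog) (h35 : FriedlanderIwaniec1998_prop35)
    (h41 : FriedlanderIwaniec1998_prop41) : setOf_prime_sq_add_pow_four_infinite :=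
  setOf_prime_sq_add_pow_four_infinite_of_primeSum
    (FriedlanderIwaniec1998_primeSum_asymp_of_rough_inputs hR h35 h41)

/-- **FI (4.7)–(4.8) from ASP Theorem 1 with (B*), FI Lemma 3.1 and FI Proposition 4.1**
(Proposition 3.5 being Lemma 3.1 plus the proved Lemma 3.4, `FriedlanderIwaniec1998_prop35_of_lemma31`).
[cite: FriedlanderIwaniecAnnals1998, §4, (4.7)-(4.8) via Lemma 3.1, Proposition 4.1] -/
theorem FriedlanderIwaniec1998_primeSum_asymp_of_rough_lemma31_inputs
    (hR : fi_asymptotic_sieve_primes_rough_loglog) (h31 : FriedlanderIwaniec1998_lemma31)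
    (h41 : FriedlanderIwaniec1998_prop41) : FriedlanderIwaniec1998_primeSum_asymp :=
  FriedlanderIwaniec1998_primeSum_asymp_of_rough_inputs hR
    (FriedlanderIwaniec1998_prop35_of_lemma31 h31) h41

/-- **Friedlander–Iwaniec Theorem 1 (parity.S17) from exactly three named facts: ASP Theorem 1 with
(B*) (`fi_asymptotic_sieve_primes_rough_loglog`), FI Lemma 3.1 (`FriedlanderIwaniec1998_lemma31`)
and FI Proposition 4.1 (`FriedlanderIwaniec1998_prop41`)** — the current trust base of parity.S17 in
the tree. [cite: FriedlanderIwaniecAnnals1998, Theorem 1 via Lemma 3.1, Propositions 2.1, 4.1] -/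
theorem friedlanderIwaniecSum_isEquivalent_of_rough_lemma31_inputs
    (hR : fi_asymptotic_sieve_primes_rough_loglog) (h31 : FriedlanderIwaniec1998_lemma31)
    (h41 : FriedlanderIwaniec1998_prop41) : friedlanderIwaniecSum_isEquivalent :=
  friedlanderIwaniecSum_isEquivalent_of_rough_inputs hR
    (FriedlanderIwaniec1998_prop35_of_lemma31 h31) h41

/-- **parity.S17, qualitative clause, from ASP Theorem 1 with (B*), FI Lemma 3.1 and FI
Proposition 4.1.** [cite: FriedlanderIwaniecAnnals1998, Theorem 1] -/
theorem setOf_prime_sq_add_pow_four_infinite_of_rough_lemma31_inputs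
    (hR : fi_asymptotic_sieve_primes_rough_loglog) (h31 : FriedlanderIwaniec1998_lemma31)
    (h41 : FriedlanderIwaniec1998_prop41) : setOf_prime_sq_add_pow_four_infinite :=
  setOf_prime_sq_add_pow_four_infinite_of_rough_inputs hR
    (FriedlanderIwaniec1998_prop35_of_lemma31 h31) h41

end Literature.NumberTheory.Sieve
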